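import Literature.IUT.HodgeTheaters.SplitReconstructibleAlongCriterion
import Literature.IUT.HodgeTheaters.GoodLocalFrobenioidOfKit
import Literature.IUT.HodgeTheaters.GoodLocalFrobenioidOfGaloisBaseRam
import Literature.AlgebraicGeometry.Frobenioids.PadicFrobenioidCdashHomImage
import Literature.AlgebraicGeometry.Frobenioids.PadicFieldwiseSaturatedPrelim
import Literature.AlgebraicGeometry.Frobenioids.PadicFrobenioidSplittingMonoid
import Literature.AlgebraicGeometry.Frobenioids.CoAngular
import Literature.AlgebraicGeometry.Frobenioids.FrTrFrobenioid
import HarnessLib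

/-!
# [IUTchI] Example 3.3 (iii) (e) at the assembled object `GoodLocalFrobenioid.ofKit`: transport of `τ⊢_v` along
# `C⊢_v ⊆ C_v` (the structural inputs of `splitFromF_of_cdashFromF_of_isPreservedBy` discharged over the [FrdII] kit)

Mochizuki, *Inter-universal Teichmüller theory I*, kurims manuscript (May 2020), Example 3.3 (iii) (e), p. 79
[claim: Mochizuki2012, status: disputed] — nothing of the series is asserted; no side is taken on [IUTchIII] Cor. 3.12.
Mochizuki, *The geometry of Frobenioids II*, Kyushu J. Math. **62** (2008), Example 1.1 (ii) p. 8, Theorem 1.2 (v) p. 9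
[cite: MochizukiFrdII2008, Thm 1.2 (v) p.9] (the splitting `τ_p` determined by `p`); *Frobenioids I*, Def. 2.3 p. 46.

PROOF-ONLY (abc-iut cell, seat abc-iut-w4-d047 gen 5; row E33iii/e of `plan/L5/SUBDAG-IUTchI-Ex33-Ex34.md`, support of the
assembly owner abc-iut-L5-t16 under L5-lead RULINGS #80), 0 definitions, no new Prop fact.  This lineage's criterion
`GoodLocalFrobenioid.splitFromF_of_cdashFromF_of_isPreservedBy` (`SplitReconstructibleAlongCriterion.lean`) reduces clause (e)
`SplitFromF` to clause (d) plus ONE statement about `C_v` ("every self-equivalence preserves a splitting `σ` of `C_v`"),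
GIVEN three structural inputs on `σ`: (hL) `σ` restricts to `τ⊢_v` along `C⊢_v ⊆ C_v`, (hM) `σ` is stable under conjugation
by isomorphisms, (hΘ) so is `τ^Θ_v`.  THIS FILE discharges (hL), (hM), (hΘ) for the object ASSEMBLED FROM abc-iut-L1-t4's
[FrdII] kit (`GoodLocalFrobenioid.ofKit`, hence for `ofGalois` and the printed object, which are instances of it) with
`σ := τ_{p_v}` of the PERFECT `p_v`-adic Frobenioid `C_v` (`Datum.pSplittingSubmonoid` of `Datum.perf`):
* `PadicFrd.Datum.pSplittingSubmonoid_map_conj` — for ANY [FrdII] datum, `τ_p` is stable under conjugation by isomorphisms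
  (isomorphisms are linear; [FrdI] Def. 2.3 subfunctoriality `mem_pSplittingSubmonoid_of_comp_eq`);
* `PadicFrd.Datum.ιHom_div_eq_pow_of_resK_unit_eq` — a base-identity linear endomorphism whose rational function
  restricts to `p^m` has zero divisor `log(p)^m` (relation (d) of [FrdI] Thm. 5.2 (i) + the cartesian square of `B`);
* `PadicFrd.GoodLocalKit.pSplittingSubmonoid_map_CdashToCOver` — **`C⊢_v ⊆ C_v` carries `τ⊢_v(A) = τ_p(A)` ONTO
  `τ_p(ιA)`** (the rational function is transported along the counit `ε : proj (incl A) → A`, field homomorphisms fix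
  `p`; surjectivity by abc-iut-L1-t4's hom-image theorem `exists_CdashToCOver_map_eq`);
* `GoodLocalFrobenioid.splitFromF_ofKit_of_isPreservedBy` — **at `ofKit`: (e) ⟸ (d) + "every self-equivalence of `C_v`
  preserves `τ_{p_v}` of `C_v`"** (`hfix`, the content of [AbsTopIII] Prop. 3.2 (iii): (E1) [FrdI] Thm. 3.4 (iv) + (E2)
  geometricity + (E3) classical unit rigidity; FALSE at the degenerate `ofKitQp`, `not_splitFromF_ofKitQp`).
Typed ≠ proved; the binder `hfix` is NOT discharged here.
-/

namespace Literature.AlgebraicGeometry.Frobenioids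

namespace PadicFrd

open CategoryTheory Opposite Function

universe v v' u

namespace Datum

variable {D : Type u} [Category.{v} D] {p : ℕ} [Fact p.Prime] (d : Datum D p)

/-- Conjugating an element of `τ_p(A)` by an isomorphism `i : A ≅ B` of the `p`-adic Frobenioid gives an element of
`τ_p(B)` (isomorphisms are linear; [FrdI] Def. 2.3 subfunctoriality along the linear `i⁻¹`).
[cite: MochizukiFrdII2008, Thm 1.2 (v) p.9] -/
theorem conj_mem_pSplittingSubmonoid {X Y : d.frobenioid} (i : X ≅ Y) {t : End X}
    (ht : t ∈ d.pSplittingSubmonoid X) : i.conj t ∈ d.pSplittingSubmonoid Y := by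
  have hmem : i.conj t ∈ PreFrobenioid.endSubmonoid d.structureFunctor Y := by
    rw [Iso.conj_apply]
    exact PreFrobenioid.endConj_mem d.structureFunctor i ht.1
  refine d.mem_pSplittingSubmonoid_of_comp_eq i.inv (PreFrobenioid.isLinear_of_isIso d.structureFunctor i.inv) ht
    hmem ?_
  change i.inv ≫ End.asHom t = (i.conj t : Y ⟶ Y) ≫ i.inv
  rw [Iso.conj_apply, Category.assoc, Category.assoc, i.hom_inv_id, Category.comp_id]

/-- **`τ_p` is stable under conjugation by isomorphisms**: `i ∘ τ_p(A) ∘ i⁻¹ = τ_p(B)` for every isomorphism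
`i : A ≅ B` of the `p`-adic Frobenioid of a [FrdII] datum ([FrdI] Def. 2.3; input (hM)/(hΘ) of this lineage's
`splitFromF_of_cdashFromF_of_isPreservedBy`). [cite: MochizukiFrdII2008, Thm 1.2 (v) p.9] -/
theorem pSplittingSubmonoid_map_conj {X Y : d.frobenioid} (i : X ≅ Y) :
    (d.pSplittingSubmonoid X).map i.conj.toMonoidHom = d.pSplittingSubmonoid Y := by
  ext s
  constructor
  · rintro ⟨t, ht, rfl⟩
    exact d.conj_mem_pSplittingSubmonoid i ht
  · intro hs
    exact ⟨i.symm.conj s, d.conj_mem_pSplittingSubmonoid i.symm hs, i.self_symm_conj s⟩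

/-- **The zero divisor of a base-identity linear endomorphism with rational function `p^m` is `log(p)^m`** (inside
`Φ₀(A) = ord(𝒪^▷_{K_A}) ⊗ ℝ_{≥0}`): relation (d) of [FrdI] Thm. 5.2 (i) gives `[Div s] = Div_B(u_s)`, and the cartesian
square of `B = K^× ×_{Φ₀^gp} Φ^gp` gives `ι^gp(Div_B(u_s)) = Div₀(u_s|_{K^×}) = Div₀(p^m)`.
[cite: MochizukiFrdII2008, Ex 1.1 (ii) p.8] -/
theorem ιHom_div_eq_pow_of_resK_unit_eq {X : d.frobenioid} {s : X ⟶ X}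
    (hs : s ∈ PreFrobenioid.endSubmonoid d.structureFunctor X) {m : ℕ}
    (hm : d.resK X.base (ModelFrobenioid.unit s) = d.primeUnit X.base ^ m) :
    d.ιHom X.base (ModelFrobenioid.div s) =
      Realification.of _ (Associates.mk ⟨((p : ℕ) : d.fld X.base), (d.base.obj X.base).p_mem⟩) ^ m := by
  haveI := isCancelMul_realification (OrdInt (d.fld X.base))
  apply Algebra.GrothendieckGroup.of_injective (M := Realification (OrdInt (d.fld X.base)))
  have h1 := d.of_div_eq_divB_unit hs
  change d.phiGp X.base (ModelFrobenioid.div s) = _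
  rw [phiGp_eq_monGp_map_of, h1, ← divZeroHom_resK, hm, map_pow, divZeroHom_primeUnit, map_pow]
  rfl

end Datum

/-! ### Along `C⊢_v ⊆ C_v` (two bases): Frobenius degree, base, rational function -/

namespace GoodLocalKit

variable {D : Type u} [Category.{v} D] {p : ℕ} [Fact p.Prime] (base : D ⥤ PadicFld.{u} p)
  (hloc : ∀ A : D, (base.obj A).IsPadicLocal) (hc : IsConnected D) (he : IsTotallyEpimorphic D)
  {Dv : Type u} [Category.{v'} Dv] (proj : Dv ⥤ D)
  (hlocv : ∀ A : Dv, ((proj ⋙ base).obj A).IsPadicLocal) (hcv : IsConnected Dv) (hev : IsTotallyEpimorphic Dv)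
  (incl : D ⥤ Dv) (ε : incl ⋙ proj ⟶ 𝟭 D)

/-- `C⊢_v → C_v` preserves Frobenius degrees (on the nose). [cite: MochizukiFrdII2008, Ex 1.1 (ii) p.8] -/
theorem degFr_CdashToCOver_map {t₁ t₂ : Cdash base hloc hc he} (g : t₁ ⟶ t₂) :
    ModelFrobenioid.degFr ((CdashToCOver base hloc hc he proj hlocv hcv hev incl ε).map g) = ModelFrobenioid.degFr g :=
  rfl

/-- `C⊢_v → C_v` covers `incl` on base arrows (on the nose). [cite: MochizukiFrdII2008, Ex 1.1 (ii) p.8] -/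
theorem baseMap_CdashToCOver_map {t₁ t₂ : Cdash base hloc hc he} (g : t₁ ⟶ t₂) :
    ModelFrobenioid.baseMap ((CdashToCOver base hloc hc he proj hlocv hcv hev incl ε).map g) =
      incl.map (ModelFrobenioid.baseMap g) :=
  rfl

/-- Injective monoid homomorphisms induce injective maps on units. [folklore] -/
private theorem units_map_injective_of_injective {M N : Type*} [Monoid M] [Monoid N] (f : M →* N)
    (hf : Injective f) : Injective (Units.map f) := fun a b h =>
  Units.ext (hf (by rw [← Units.coe_map f a, ← Units.coe_map f b, h]))

/-- **The rational function along `C⊢_v → C_v`**: `u_{ι g}|_{K^×} = σ_ε(u_g|_{K^×})`, `σ_ε` the field homomorphism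
under the counit arrow `ε_A : proj(incl A) → A` (the data inclusion `B⊢ ⊆ B` does not change the `K^×`-component; the
transport along `ε` is `B(ε_A)`, whose `K^×`-component is `σ_ε` by naturality of `B → B₀`).
[cite: MochizukiFrdII2008, Ex 1.1 (ii) p.8] -/
theorem resK_unit_CdashToCOver_map {t₁ t₂ : Cdash base hloc hc he} (g : t₁ ⟶ t₂) :
    (Datum.perf (proj ⋙ base) hlocv hcv hev).resK
        ((CdashToCOver base hloc hc he proj hlocv hcv hev incl ε).obj t₁).base
        (ModelFrobenioid.unit ((CdashToCOver base hloc hc he proj hlocv hcv hev incl ε).map g)) =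
      Units.map (((Datum.perf base hloc hc he).base.map (ε.app t₁.base)).alg :
          (Datum.perf base hloc hc he).fld ((𝟭 D).obj t₁.base) →*
            (Datum.perf base hloc hc he).fld ((incl ⋙ proj).obj t₁.base))
        ((Datum.prim base hloc hc he).resK t₁.base (ModelFrobenioid.unit g)) :=
  (Datum.perf base hloc hc he).resK_mapB (ε.app t₁.base) _

/-- **`C⊢_v ⊆ C_v` carries `τ⊢_v(A) = τ_p(A)` ONTO `τ_p(ιA)`** (input (hL) of this lineage's
`splitFromF_of_cdashFromF_of_isPreservedBy` at the [FrdII] kit): an element of `τ_p(A)` (base-identity linear, rational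
function `p^m`) goes to one of `τ_p(ιA)` (field homomorphisms fix `p`); conversely an element of `τ_p(ιA)` has zero divisor
`log(p_v)^m`, so lies in the hom-image of the non-full `C⊢_v ⊆ C_v` (abc-iut-L1-t4's `exists_CdashToCOver_map_eq`), and
its preimage is in `τ_p(A)` (`incl` faithful; `σ_ε` injective on units). [cite: MochizukiFrdII2008, Thm 1.2 (v) p.9] -/
theorem pSplittingSubmonoid_map_CdashToCOver [incl.Full] [incl.Faithful] [IsIso ε] (t : Cdash base hloc hc he) :
    ((Datum.prim base hloc hc he).pSplittingSubmonoid t).map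
        ((CdashToCOver base hloc hc he proj hlocv hcv hev incl ε).mapEnd t) =
      (Datum.perf (proj ⋙ base) hlocv hcv hev).pSplittingSubmonoid
        ((CdashToCOver base hloc hc he proj hlocv hcv hev incl ε).obj t) := by
  -- `σ_ε` is injective on units and fixes `p`
  have hσ := units_map_injective_of_injective
    (((Datum.perf base hloc hc he).base.map (ε.app t.base)).alg :
      (Datum.perf base hloc hc he).fld ((𝟭 D).obj t.base) →* (Datum.perf base hloc hc he).fld ((incl ⋙ proj).obj t.base))
    ((Datum.perf base hloc hc he).base.map (ε.app t.base)).alg.injective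
  have hσp : Units.map (((Datum.perf base hloc hc he).base.map (ε.app t.base)).alg :
      (Datum.perf base hloc hc he).fld ((𝟭 D).obj t.base) →* (Datum.perf base hloc hc he).fld ((incl ⋙ proj).obj t.base))
        ((Datum.prim base hloc hc he).primeUnit t.base) =
      (Datum.perf (proj ⋙ base) hlocv hcv hev).primeUnit
        ((CdashToCOver base hloc hc he proj hlocv hcv hev incl ε).obj t).base :=
    (Datum.perf base hloc hc he).units_map_primeUnit (ε.app t.base)
  ext s
  constructor
  · rintro ⟨g, ⟨⟨hb, hd⟩, m, hm⟩, rfl⟩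
    have hb' : ModelFrobenioid.baseMap (End.asHom g) = 𝟙 t.base := hb
    refine ⟨⟨?_, hd⟩, m, ?_⟩
    · change ModelFrobenioid.baseMap ((CdashToCOver base hloc hc he proj hlocv hcv hev incl ε).map (End.asHom g)) =
        𝟙 (incl.obj t.base)
      rw [baseMap_CdashToCOver_map, hb', incl.map_id]
    · change (Datum.perf (proj ⋙ base) hlocv hcv hev).resK
          ((CdashToCOver base hloc hc he proj hlocv hcv hev incl ε).obj t).base
          (ModelFrobenioid.unit ((CdashToCOver base hloc hc he proj hlocv hcv hev incl ε).map (End.asHom g))) = _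
      rw [resK_unit_CdashToCOver_map, hm]
      exact (map_pow _ _ m).trans (congrArg (· ^ m) hσp)
  · rintro ⟨⟨hb, hd⟩, m, hm⟩
    have hb' : ModelFrobenioid.baseMap (End.asHom s) = 𝟙 (incl.obj t.base) := hb
    have hd' : ModelFrobenioid.degFr (End.asHom s) = 1 := hd
    -- `Div(s) = log(p_v)^m`, so `s` lies in the hom-image of `C⊢_v ⊆ C_v`
    have hdiv := (Datum.perf (proj ⋙ base) hlocv hcv hev).ιHom_div_eq_pow_of_resK_unit_eq ⟨hb, hd⟩ hm
    obtain ⟨g, hg⟩ := exists_CdashToCOver_map_eq base hloc hc he proj hlocv hcv hev incl ε (End.asHom s)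
      ((Submonoid.mem_powers_iff _ _).mpr ⟨m, hdiv.symm⟩)
    refine ⟨End.of g, ⟨⟨?_, ?_⟩, m, ?_⟩, hg⟩
    · -- base: `incl(Base g) = Base(ι g) = Base s = 𝟙`, and `incl` is faithful
      change ModelFrobenioid.baseMap g = 𝟙 t.base
      apply incl.map_injective
      rw [← baseMap_CdashToCOver_map base hloc hc he proj hlocv hcv hev incl ε g, hg, hb', incl.map_id]
    · change ModelFrobenioid.degFr g = 1
      rw [← degFr_CdashToCOver_map base hloc hc he proj hlocv hcv hev incl ε g, hg]
      exact hd'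
    · apply hσ
      have h1 : (Datum.perf (proj ⋙ base) hlocv hcv hev).resK
          ((CdashToCOver base hloc hc he proj hlocv hcv hev incl ε).obj t).base
          (ModelFrobenioid.unit ((CdashToCOver base hloc hc he proj hlocv hcv hev incl ε).map g)) =
          (Datum.perf (proj ⋙ base) hlocv hcv hev).primeUnit
            ((CdashToCOver base hloc hc he proj hlocv hcv hev incl ε).obj t).base ^ m := by
        rw [hg]; exact hm
      exact ((resK_unit_CdashToCOver_map base hloc hc he proj hlocv hcv hev incl ε g).symm.trans h1).trans
        ((map_pow _ _ m).trans (congrArg (· ^ m) hσp)).symm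

end GoodLocalKit

end PadicFrd

end Literature.AlgebraicGeometry.Frobenioids

/-! ### At `GoodLocalFrobenioid.ofKit`: (e) ⟸ (d) + "self-equivalences of `C_v` preserve `τ_{p_v}`" -/

namespace Literature.IUT.HodgeTheaters

namespace GoodLocalFrobenioid

open CategoryTheory Opposite Literature.AlgebraicGeometry.Frobenioids Literature.AlgebraicGeometry.Frobenioids.PadicFrd
open Literature.AnabelianGeometry.SemiGraphs Topology

universe u

variable {p : ℕ} [Fact p.Prime] {Dv Dd : Type u} [Category.{u} Dv] [Category.{u} Dd]
  (incl : Dd ⥤ Dv) (proj : Dv ⥤ Dd) (adj : proj ⊣ incl)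
  (base : Dd ⥤ PadicFld.{u} p) (hloc : ∀ A : Dd, (base.obj A).IsPadicLocal)
  (hc : IsConnected Dd) (he : IsTotallyEpimorphic Dd) (hcV : IsConnected Dv) (heV : IsTotallyEpimorphic Dv)
  (Kv : Type) [Field Kv] [ValuativeRel Kv] (hp : ((p : Kv)) ∈ PadicFrd.intNonzero Kv) [incl.Full] [incl.Faithful]

/-- **[IUTchI] Ex. 3.3 (iii) (e) at the assembled `ofKit`, reduced to ONE statement about `C_v`.**  With
`σ := τ_{p_v}` of the PERFECT `p_v`-adic Frobenioid `C_v` (inputs (hL), (hM), (hΘ) of this lineage's criterion being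
THEOREMS over the [FrdII] kit: `pSplittingSubmonoid_map_CdashToCOver`, `pSplittingSubmonoid_map_conj`): clause (e)
`SplitFromF` follows from clause (d) `CdashFromF` and `hfix` — every self-equivalence of `C_v` preserves `τ_{p_v}` (the
Kummer-theoretic content of print's "[AbsTopIII] Prop. 3.2 (iii)"; NOT discharged here; false at the degenerate
`ofKitQp`). ([IUTchI] Ex 3.3 (iii) (e) p.79) [claim: Mochizuki2012, status: disputed] -/
theorem splitFromF_ofKit_of_isPreservedBy (hd : (ofKit incl proj adj base hloc hc he hcV heV Kv hp).CdashFromF)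
    (hfix : ∀ e : (ofKit incl proj adj base hloc hc he hcV heV Kv hp).Cv ≌ (ofKit incl proj adj base hloc hc he hcV heV Kv hp).Cv,
      S3Local.CharSplitting.IsPreservedBy
        ⟨(Datum.perf (proj ⋙ base) (hlocOver proj base hloc) hcV heV).pSplittingSubmonoid⟩
        ⟨(Datum.perf (proj ⋙ base) (hlocOver proj base hloc) hcV heV).pSplittingSubmonoid⟩ e.functor) :
    (ofKit incl proj adj base hloc hc he hcV heV Kv hp).SplitFromF :=
  (ofKit incl proj adj base hloc hc he hcV heV Kv hp).splitFromF_of_cdashFromF_of_isPreservedBy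
    ⟨(Datum.perf (proj ⋙ base) (hlocOver proj base hloc) hcV heV).pSplittingSubmonoid⟩
    (fun A => GoodLocalKit.pSplittingSubmonoid_map_CdashToCOver base hloc hc he proj (hlocOver proj base hloc) hcV heV
      incl adj.counit A)
    (fun _ _ i => (Datum.perf (proj ⋙ base) (hlocOver proj base hloc) hcV heV).pSplittingSubmonoid_map_conj i)
    (fun _ _ i => (Datum.prim base hloc hc he).pSplittingSubmonoid_map_conj i)
    hd hfix

/-! ### Over the REAL bases `D_v = 𝓑(Π_v)⁰ ⊇ D⊢_v = 𝓑(G_v)⁰` and at `Ω = k̄` -/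

section OfGalois

variable (d : GaloisValDatum.{u} p) {P : Type u} [Group P] [TopologicalSpace P]
  (aug : P →* d.Gal) (hc' : Continuous aug) (hs : Function.Surjective aug) (ho : IsOpenMap aug)

/-- **[IUTchI] Ex. 3.3 (iii) (e) over the REAL bases** (`GoodLocalFrobenioid.ofGalois`: `D_v = CosetCat Π_v`, `D⊢_v`
pulled back along `aug : Π_v ↠ G_v`): clause (e) follows from clause (d) and `hfix` (every self-equivalence of the REAL
`p_v`-adic Frobenioid `C_v` preserves `τ_{p_v}`). ([IUTchI] Ex 3.3 (iii) (e) p.79) [claim: Mochizuki2012, status: disputed] -/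
theorem splitFromF_ofGalois_of_isPreservedBy (hd : (ofGalois d aug hc' hs ho Kv hp).CdashFromF)
    (hfix : ∀ e : (ofGalois d aug hc' hs ho Kv hp).Cv ≌ (ofGalois d aug hc' hs ho Kv hp).Cv,
      S3Local.CharSplitting.IsPreservedBy
        ⟨(Datum.perf (CosetCat.push aug ho ⋙ d.fieldFunctor)
            (hlocOver (CosetCat.push aug ho) d.fieldFunctor d.fieldFunctor_isPadicLocal)
            CosetCat.isConnected CosetCat.isTotallyEpimorphic).pSplittingSubmonoid⟩
        ⟨(Datum.perf (CosetCat.push aug ho ⋙ d.fieldFunctor)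
            (hlocOver (CosetCat.push aug ho) d.fieldFunctor d.fieldFunctor_isPadicLocal)
            CosetCat.isConnected CosetCat.isTotallyEpimorphic).pSplittingSubmonoid⟩ e.functor) :
    (ofGalois d aug hc' hs ho Kv hp).SplitFromF := by
  haveI := CosetCat.pull_full aug hc' hs
  haveI := CosetCat.pull_faithful aug hc' hs
  exact splitFromF_ofKit_of_isPreservedBy (CosetCat.pull aug hc' hs) (CosetCat.push aug ho)
    (CosetCat.pushPullAdj aug hc' hs ho) d.fieldFunctor d.fieldFunctor_isPadicLocal CosetCat.isConnected
    CosetCat.isTotallyEpimorphic CosetCat.isConnected CosetCat.isTotallyEpimorphic Kv hp hd hfix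

end OfGalois

section OfComplete

variable (p) (k : Type) [NontriviallyNormedField k] [CompleteSpace k] [IsUltrametricDist k] [NormedAlgebra ℚ_[p] k]
  [FiniteDimensional ℚ_[p] k] {P : Type} [Group P] [TopologicalSpace P]
  (aug : P →* (GaloisValDatum.ofComplete p k).Gal) (hc' : Continuous aug) (hs : Function.Surjective aug)
  (ho : IsOpenMap aug)

/-- **[IUTchI] Ex. 3.3 (iii) (e) over the REAL bases at `Ω = k̄` (`k` complete, finite over `ℚ_p`), reduced to ONE
binder**: for `Π_v` profinite-tempered and second countable over `G_v = Gal(k̄/k)`, given [AbsAnab] Lem. 1.3.8 in the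
shape `hΔ` (FACT F-0007) and the slimness of `𝓑(Π_v)⁰` — under which clause (d) is a THEOREM (abc-iut-L5-t16's
`cdashFromF_ofGalois_ofComplete`) — the split clause (e) `SplitFromF` follows from `hfix`: every self-equivalence of the
REAL `p_v`-adic Frobenioid `C_v` preserves `τ_{p_v}` (= (E1) [FrdI] Thm. 3.4 (iv) + (E2) [AbsTopIII] Thm. 1.9 /
Prop. 3.2 (iii) + (E3) classical unit rigidity, L5-lead RULINGS #80). ([IUTchI] Ex 3.3 (iii) (e) p.79)
[claim: Mochizuki2012, status: disputed] -/
theorem splitFromF_ofGalois_ofComplete_of_isPreservedBy [IsTopologicalGroup P] [SecondCountableTopology P]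
    (hP : IsTempered P) (hΔ : ∀ φ : P ≃ₜ* P, aug.ker.map φ.toMulEquiv.toMonoidHom = aug.ker)
    (hsl : IsSlim (CosetCat P))
    (hfix : ∀ e : (ofGalois (GaloisValDatum.ofComplete p k) aug hc' hs ho Kv hp).Cv ≌
        (ofGalois (GaloisValDatum.ofComplete p k) aug hc' hs ho Kv hp).Cv,
      S3Local.CharSplitting.IsPreservedBy
        ⟨(Datum.perf (CosetCat.push aug ho ⋙ (GaloisValDatum.ofComplete p k).fieldFunctor)
            (hlocOver (CosetCat.push aug ho) (GaloisValDatum.ofComplete p k).fieldFunctor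
              (GaloisValDatum.ofComplete p k).fieldFunctor_isPadicLocal)
            CosetCat.isConnected CosetCat.isTotallyEpimorphic).pSplittingSubmonoid⟩
        ⟨(Datum.perf (CosetCat.push aug ho ⋙ (GaloisValDatum.ofComplete p k).fieldFunctor)
            (hlocOver (CosetCat.push aug ho) (GaloisValDatum.ofComplete p k).fieldFunctor
              (GaloisValDatum.ofComplete p k).fieldFunctor_isPadicLocal)
            CosetCat.isConnected CosetCat.isTotallyEpimorphic).pSplittingSubmonoid⟩ e.functor) :
    (ofGalois (GaloisValDatum.ofComplete p k) aug hc' hs ho Kv hp).SplitFromF :=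
  splitFromF_ofGalois_of_isPreservedBy Kv hp (GaloisValDatum.ofComplete p k) aug hc' hs ho
    (cdashFromF_ofGalois_ofComplete p k aug hc' hs ho Kv hp hP hΔ hsl) hfix

end OfComplete

end GoodLocalFrobenioid

/-! ### At the printed object: the initial Θ-datum at `v̲ ∈ V̲^good ∩ V̲^non`, `K_v̲ = k` -/

section Datum

open CategoryTheory Literature.AnabelianGeometry.SemiGraphs Literature.AlgebraicGeometry.Frobenioids
open Literature.AlgebraicGeometry.Frobenioids.PadicFrd Literature.AnabelianGeometry.AbsoluteAnabelian

universe v w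

variable {F : Type v} {K : Type w} {Fbar : Type} [Field F] [NumberField F] [Field K] [NumberField K]
  [Algebra F K] [Field Fbar] [Algebra F Fbar] [Algebra K Fbar] [IsScalarTower F K Fbar] [Normal K Fbar]
  {E : WeierstrassCurve F} [E.IsElliptic] {l : ℕ} {Pb : BadPlacePredicates K}
  (D : InitialThetaData F K Fbar E l Pb) (p : ℕ) [Fact p.Prime]
  (k : Type) [NontriviallyNormedField k] [CompleteSpace k] [IsUltrametricDist k] [NormedAlgebra ℚ_[p] k]
  [FiniteDimensional ℚ_[p] k] [Algebra K k]

namespace InitialThetaData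

/-- **[IUTchI] Ex. 3.3 (iii) (e) AT THE PRINTED OBJECT, reduced to ONE binder.**  For abc-iut-L5-t2's Def. 3.1 datum `D`
at `v̲ ∈ V̲^good ∩ V̲^non`, `K_v̲ = k`, `Π_v̲ := Π_{X̲→_K} ×_{G_K} Gal(k̄/k)` along `ι : F̄ → k̄`: GIVEN the openness `hX`
(Def. 3.1 (f)), the density of `K` in `k`, the named anabelian inputs `hΔC` ([AbsAnab] Lem. 1.3.1, FACT F-0004) and `hΔ`
([AbsAnab] Lem. 1.3.8, FACT F-0007) — under which (d) holds (abc-iut-L5-t16) — the split clause (e) (`F⊢_v̲`, `F^Θ_v̲`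
from `F̲_v̲`) follows from `hfix`: every self-equivalence of the REAL `C_v̲` preserves `τ_{p_v}` ([AbsTopIII] Prop. 3.2 (iii);
NOT discharged here). ([IUTchI] Ex 3.3 (iii) (e) p.79) [claim: Mochizuki2012, status: disputed] -/
theorem splitFromF_goodLocalFrobenioidOfEmb_of_isPreservedBy [SecondCountableTopology D.PiC]
    (ι : Fbar →ₐ[K] AlgebraicClosure k) (hX : IsOpen (D.PiXarrow : Set D.PiC)) (hd : DenseRange (algebraMap K k))
    (hΔC : IsSlimGroup D.DeltaC)
    (hΔ : ∀ φ : D.PiLoc D.PiXarrow (localToGF F k ι) ≃ₜ* D.PiLoc D.PiXarrow (localToGF F k ι),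
      (D.augLoc D.PiXarrow (localToGF F k ι)).ker.map φ.toMulEquiv.toMonoidHom =
        (D.augLoc D.PiXarrow (localToGF F k ι)).ker)
    (hfix : ∀ e : @GoodLocalFrobenioid.Cv p k _ (GaloisValDatum.normVal k) (D.goodLocalFrobenioidOfEmb p k ι hX) ≌
        @GoodLocalFrobenioid.Cv p k _ (GaloisValDatum.normVal k) (D.goodLocalFrobenioidOfEmb p k ι hX),
      S3Local.CharSplitting.IsPreservedBy
        ⟨(Datum.perf (CosetCat.push (D.augLoc D.PiXarrow (localToGF F k ι))
              (D.isOpenMap_augLoc D.PiXarrow (localToGF F k ι) hX (continuous_localToGF F k ι)) ⋙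
              (GaloisValDatum.ofComplete p k).fieldFunctor)
            (GoodLocalFrobenioid.hlocOver (CosetCat.push (D.augLoc D.PiXarrow (localToGF F k ι))
              (D.isOpenMap_augLoc D.PiXarrow (localToGF F k ι) hX (continuous_localToGF F k ι)))
              (GaloisValDatum.ofComplete p k).fieldFunctor (GaloisValDatum.ofComplete p k).fieldFunctor_isPadicLocal)
            CosetCat.isConnected CosetCat.isTotallyEpimorphic).pSplittingSubmonoid⟩
        ⟨(Datum.perf (CosetCat.push (D.augLoc D.PiXarrow (localToGF F k ι))
              (D.isOpenMap_augLoc D.PiXarrow (localToGF F k ι) hX (continuous_localToGF F k ι)) ⋙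
              (GaloisValDatum.ofComplete p k).fieldFunctor)
            (GoodLocalFrobenioid.hlocOver (CosetCat.push (D.augLoc D.PiXarrow (localToGF F k ι))
              (D.isOpenMap_augLoc D.PiXarrow (localToGF F k ι) hX (continuous_localToGF F k ι)))
              (GaloisValDatum.ofComplete p k).fieldFunctor (GaloisValDatum.ofComplete p k).fieldFunctor_isPadicLocal)
            CosetCat.isConnected CosetCat.isTotallyEpimorphic).pSplittingSubmonoid⟩ e.functor) :
    @GoodLocalFrobenioid.SplitFromF p k _ (GaloisValDatum.normVal k) (D.goodLocalFrobenioidOfEmb p k ι hX) := by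
  letI := GaloisValDatum.normVal k
  haveI := GaloisValDatum.charZero p k
  haveI : CompactSpace (D.PiLoc D.PiXarrow (localToGF F k ι)) :=
    D.compactSpace_PiLoc D.PiXarrow (localToGF F k ι) hX (continuous_localToGF F k ι)
  haveI := D.secondCountableTopology_galLoc p k ι hd
  haveI : SecondCountableTopology (D.PiLoc D.PiXarrow (localToGF F k ι)) :=
    (inferInstance : SecondCountableTopology
      ((D.PiLoc D.PiXarrow (localToGF F k ι) : Set (D.PiC × (AlgebraicClosure k ≃ₐ[k] AlgebraicClosure k)))))
  exact GoodLocalFrobenioid.splitFromF_ofGalois_ofComplete_of_isPreservedBy (p := p) (Kv := k)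
    (hp := GaloisValDatum.p_mem_normVal p k) (k := k) (aug := D.augLoc D.PiXarrow (localToGF F k ι))
    (hc' := D.continuous_augLoc D.PiXarrow (localToGF F k ι)) (hs := D.augLoc_PiXarrow_surjective k ι)
    (ho := D.isOpenMap_augLoc D.PiXarrow (localToGF F k ι) hX (continuous_localToGF F k ι))
    IsTempered.of_profinite hΔ
    (PadicFrd.isSlim_cosetCat_of_isSlimGroup (D.isSlimGroup_PiLoc_PiXarrow_of_geom_slim p k hΔC ι hX)) hfix

end InitialThetaData

end Datum

end Literature.IUT.HodgeTheaters
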